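import Summits.AtomisticToContinuum.Crystallization.Theorems.PricedLinkCensusStackingHingeLjSummable
import Summits.AtomisticToContinuum.Crystallization.Theorems.ReggeStarCoercivityDefectFreeCrystallizesSiteColumnLJ
import Summits.AtomisticToContinuum.Crystallization.Theorems.HullExactificationCascadeHcpLandscapeGapStubExactWindowEnergy
import Summits.AtomisticToContinuum.Crystallization.Theorems.PhononSlackCertificatesPeriodicGivenLayeredClosing1

/-!
# `HcpLandscapeGap` (stmt-AtomisticToContinuum-12087), line `registered` (birth): stub RC-W3
# `stub_freeBlockBounds` — free-block bounds for the relaxed column inequality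

Write `Φ(t, δ) = layerInteraction V_LJ a t δ 1` for the interaction of one site with a full triangular
layer at height `t` and letter offset `δ`, and `par k = 0` if `k` is even, `1` otherwise (the ALTERNATING
registry pattern).  The free-block energy of `n + 1` layers with increments `Δ` is
`F_n(Δ) = Σ_{i<j≤n} Φ(Δ i + ⋯ + Δ (j-1), par (j-i))` (verbatim the functional of `LayeredHull.stub_convexity`).

* **(a)** For `a ∈ [47/50, 1]`, heights `z` with increments `≥ 39a/50` and a column of layers
  `M₁, …, M₁ + n`, the column sum of the full alternating-pattern layer series
  `S(m) = Σ'_{k ≠ m} Φ(z k - z m, par (k - m))` is `≥ 2 F_n(Δ) - C` with `Δ l = z (M₁+l+1) - z (M₁+l)` and an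
  absolute constant `C = 2 · (192 / (39·47/2500)⁴) · (Σ_e e⁻²)²`.  Proof (`FreeBlockBounds.column_lower`,
  stated for an abstract symmetric pair interaction with quartic decay): each `S(m)` (summable by
  `LayeredHull.cake_summable_of_layer_bound`) splits into the pairs inside the column — counted twice, and
  `Σ_{l ∈ [i,j)} Δ l = z (M₁+j) - z (M₁+i)`, `Φ` even in the height (`clo_layerInteraction_neg_height`) — and
  the pairs with a layer outside the column, each bounded by `192 / (z k - z m)⁴ ≤ A / (k - m)⁴`
  (`LayeredHull.cake_abs_layerInteraction_le`, gaps `≥ 39·47/2500`); the factorisation `(d + e)⁴ ≥ (d + 1)² e²` (`d ≥ 0` the distance of `m` to the end of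
  the column, `e ≥ 1` the overshoot of `k`) bounds the double tail sum by `A (Σ e⁻²)²` per side.
* **(b)** For `h` in the band the UNIFORM free block dominates the bulk: `(n+1)(2·hcpE a h - Φ₀(a)) ≤ 2 F_n(h·1)`.
  Proof: `2·hcpE a h = Φ₀ + 2 Σ_{k ≥ 1} Φ_k`, `Φ_k = Φ(k h, par k)`
  (`PalmGoodLaw.SiteColumnLJ.barlowSiteEnergy_alternating_eq_hcpE` + the layer form of `barlowSiteEnergy`,
  `tsum_inLayer` / `tsum_layer_above` / `tsum_layer_below`, `haggAligned_alternating_iff`, and the reindexing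
  `layerInteraction V a h δ k = layerInteraction V a (k h) δ 1`); every `Φ_k ≤ 0` (all pair interactions in a
  Barlow stacking on the box are `≤ 0`, `ExactWindowEnergy.lennardJones_dist_barlowPos_nonpos`); so each of the
  `n` rows `Σ_{j ∈ (i, n]} Φ_{j-i}` of `F_n(h·1)` is `≥ Σ_{k ≥ 1} Φ_k`, and `n Σ_k Φ_k ≥ (n+1) Σ_k Φ_k`.
All `[folklore]`.
-/

namespace Summit.AtomisticToContinuum.Crystallization.Theorems.HcpLandscapeGapBirth

open Literature.MathematicalPhysics.StatisticalMechanics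
open Summit.AtomisticToContinuum.Crystallization.Theorems
open Summit.AtomisticToContinuum.Crystallization.Theorems.LayeredHull
open Summit.AtomisticToContinuum.Crystallization.Theorems.PricedHcpWindowsLjSummable
  (ljs_layerInteraction_height)
open Summit.AtomisticToContinuum.Crystallization.Theorems.PalmGoodLaw.SiteColumnLJ
  (barlowSiteEnergy_alternating_eq_hcpE)
open Summit.AtomisticToContinuum.Crystallization.Theorems.PalmUnimodularRigidity.LayeredLawsSelectHcp (hcpE)

namespace FreeBlockBounds

/-! ## Finite bookkeeping -/

/-- A symmetric off-diagonal double sum over a square is twice the sum over the strict upper triangle,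
the latter organised by rows `i < n` and columns `j ∈ (i, n]`. [folklore] -/
theorem sum_sum_ite_eq_two_mul (W : ℕ → ℕ → ℝ) (hW : ∀ d e, W d e = W e d) (n : ℕ) :
    ∑ d ∈ Finset.range (n + 1), ∑ e ∈ Finset.range (n + 1), (if e = d then 0 else W d e) =
      2 * ∑ i ∈ Finset.range n, ∑ j ∈ Finset.Ioc i n, W i j := by
  induction n with
  | zero => simp
  | succ n ih =>
    have h1 : ∀ d ∈ Finset.range (n + 1), (if n + 1 = d then 0 else W d (n + 1)) = W d (n + 1) :=
      fun d hd => if_neg (by rw [Finset.mem_range] at hd; omega)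
    have h2 : ∀ e ∈ Finset.range (n + 1), (if e = n + 1 then 0 else W (n + 1) e) = W e (n + 1) :=
      fun e he => by rw [if_neg (by rw [Finset.mem_range] at he; omega), hW]
    have h3 : ∀ i ∈ Finset.range (n + 1), ∑ j ∈ Finset.Ioc i (n + 1), W i j =
        ∑ j ∈ Finset.Ioc i n, W i j + W i (n + 1) :=
      fun i hi => Finset.sum_Ioc_succ_top (by rw [Finset.mem_range] at hi; omega) _
    rw [Finset.sum_range_succ _ (n + 1), Finset.sum_range_succ _ (n + 1),
      Finset.sum_congr rfl fun d _ => Finset.sum_range_succ (fun e => if e = d then 0 else W d e) (n + 1),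
      Finset.sum_add_distrib, ih, Finset.sum_congr rfl h1, Finset.sum_congr rfl h2, if_pos rfl,
      Finset.sum_congr rfl h3, Finset.sum_add_distrib,
      Finset.sum_range_succ (fun i => ∑ j ∈ Finset.Ioc i n, W i j) n, Finset.Ioc_self, Finset.sum_empty]
    ring

/-- A sum over the integer interval `[M, M + n]` as a sum over `range (n + 1)`. [folklore] -/
theorem sum_Icc_eq_sum_range (φ : ℤ → ℝ) (M : ℤ) (n : ℕ) :
    ∑ m ∈ Finset.Icc M (M + n), φ m = ∑ d ∈ Finset.range (n + 1), φ (M + d) := by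
  rw [Int.Icc_eq_finset_map, Finset.sum_map, show (M + n + 1 - M).toNat = n + 1 by omega]
  simp only [Function.Embedding.trans_apply, addLeftEmbedding_apply, Nat.castEmbedding_apply]

/-- Telescoping of the increments: `Σ_{l ∈ [i, j)} (z (M+l+1) - z (M+l)) = z (M+j) - z (M+i)`. [folklore] -/
theorem telescope (z : ℤ → ℝ) (M : ℤ) {i j : ℕ} (hij : i ≤ j) :
    ∑ l ∈ Finset.Ico i j, (z (M + l + 1) - z (M + l)) = z (M + j) - z (M + i) := by
  induction j, hij using Nat.le_induction with
  | base => simp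
  | succ j hij ih => rw [Finset.sum_Ico_succ_top hij, ih]; push_cast; ring

/-! ## The tail count -/

/-- Finite sums of `e⁻²` over (the image of) an injection into `ℕ` are bounded by `Σ_e e⁻²` (the value
`φ = 0` contributes `0⁻² = 0` and may be taken by many indices). [folklore] -/
theorem sum_inv_sq_le (s : Finset ℤ) (φ : ℤ → ℕ) (hφ : Set.InjOn φ {k | φ k ≠ 0}) :
    ∑ k ∈ s, 1 / ((φ k : ℕ) : ℝ) ^ 2 ≤ ∑' e : ℕ, 1 / (e : ℝ) ^ 2 := by
  rw [← Finset.sum_filter_add_sum_filter_not s fun k => φ k ≠ 0]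
  have h0 : ∑ k ∈ s.filter (fun k => ¬φ k ≠ 0), 1 / ((φ k : ℕ) : ℝ) ^ 2 = 0 :=
    Finset.sum_eq_zero fun k hk => by
      rw [Finset.mem_filter, not_not] at hk
      simp [hk.2]
  have hinj : Set.InjOn φ ↑(s.filter fun k => φ k ≠ 0) := fun k hk k' hk' h =>
    hφ (Finset.mem_filter.1 (Finset.mem_coe.1 hk)).2 (Finset.mem_filter.1 (Finset.mem_coe.1 hk')).2 h
  rw [h0, add_zero, ← Finset.sum_image (f := fun e : ℕ => 1 / (e : ℝ) ^ 2) hinj]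
  exact (Real.summable_one_div_nat_pow.2 one_lt_two).sum_le_tsum _ fun _ _ => by positivity

/-- The factorisation step of the tail count: `(d + 1) e ≤ (d + e)²` for `d ≥ 0`, `e ≥ 1`, in the form
`A / (d + e)⁴ ≤ A / (d + 1)² · e⁻²`. [folklore] -/
theorem div_pow_four_le {A d e : ℝ} (hA : 0 ≤ A) (hd : 0 ≤ d) (he : 1 ≤ e) :
    A / (d + e) ^ 4 ≤ A / (d + 1) ^ 2 * (1 / e ^ 2) := by
  have h1 : (d + 1) * e ≤ (d + e) ^ 2 := by nlinarith
  have h2 : ((d + 1) * e) ^ 2 ≤ (d + e) ^ 4 := by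
    calc ((d + 1) * e) ^ 2 ≤ ((d + e) ^ 2) ^ 2 := pow_le_pow_left₀ (by positivity) h1 2
      _ = (d + e) ^ 4 := by ring
  calc A / (d + e) ^ 4 ≤ A / ((d + 1) * e) ^ 2 := div_le_div_of_nonneg_left hA (by positivity) h2
    _ = A / (d + 1) ^ 2 * (1 / e ^ 2) := by rw [mul_pow, mul_one_div, div_div]

/-- **The pairs with a layer outside the column.** If `|g k| ≤ A / (k - m)⁴` off the column `[M₁, M₁ + n] ∋ m`,
then the series of `g` restricted to the complement of the column is
`≥ -A · ((m - M₁ + 1)⁻² + (M₁ + n - m + 1)⁻²) · Σ_e e⁻²`. [folklore] -/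
theorem tail_lower {A : ℝ} (hA : 0 ≤ A) (M₁ : ℤ) (n : ℕ) {m : ℤ} (hm : m ∈ Finset.Icc M₁ (M₁ + n))
    (g : ℤ → ℝ) (hg : ∀ k, k ∉ Finset.Icc M₁ (M₁ + n) → |g k| ≤ A / ((k : ℝ) - m) ^ 4) :
    -(A * (1 / (((m - (M₁ - 1)).toNat : ℕ) : ℝ) ^ 2 + 1 / (((M₁ + n + 1 - m).toNat : ℕ) : ℝ) ^ 2) *
        ∑' e : ℕ, 1 / (e : ℝ) ^ 2) ≤
      ∑' k : ℤ, ((↑(Finset.Icc M₁ (M₁ + n)) : Set ℤ)ᶜ).indicator g k := by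
  rw [Finset.mem_Icc] at hm
  have hZ0 : (0 : ℝ) ≤ ∑' e : ℕ, 1 / (e : ℝ) ^ 2 := tsum_nonneg fun _ => by positivity
  have hm1 : (M₁ : ℝ) ≤ m := by exact_mod_cast hm.1
  have hm2 : (m : ℝ) ≤ M₁ + n := by exact_mod_cast hm.2
  have hp : (((m - (M₁ - 1)).toNat : ℕ) : ℝ) = (m : ℝ) - M₁ + 1 := by
    rw [← Int.cast_natCast ((m - (M₁ - 1)).toNat), Int.toNat_of_nonneg (by omega)]; push_cast; ring
  have hp' : (((M₁ + n + 1 - m).toNat : ℕ) : ℝ) = (M₁ : ℝ) + n - m + 1 := by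
    rw [← Int.cast_natCast ((M₁ + n + 1 - m).toNat), Int.toNat_of_nonneg (by omega)]; push_cast; ring
  rw [hp, hp']
  -- pointwise majorant of `-indicator`
  have hgB : ∀ k, -(((↑(Finset.Icc M₁ (M₁ + n)) : Set ℤ)ᶜ).indicator g k) ≤
      A / ((m : ℝ) - M₁ + 1) ^ 2 * (1 / (((M₁ - k).toNat : ℕ) : ℝ) ^ 2) +
        A / ((M₁ : ℝ) + n - m + 1) ^ 2 * (1 / (((k - (M₁ + n)).toNat : ℕ) : ℝ) ^ 2) := by
    intro k
    by_cases hk : k ∈ Finset.Icc M₁ (M₁ + n)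
    · rw [Set.indicator_of_notMem (by simpa using hk), neg_zero]
      positivity
    · rw [Set.indicator_of_mem (by simpa using hk)]
      refine (neg_le_abs _).trans ((hg k hk).trans ?_)
      rw [Finset.mem_Icc, not_and_or, not_le, not_le] at hk
      rcases hk with hk | hk
      · have hq : (((M₁ - k).toNat : ℕ) : ℝ) = (M₁ : ℝ) - k := by
          rw [← Int.cast_natCast ((M₁ - k).toNat), Int.toNat_of_nonneg (by omega)]; push_cast; ring
        have hk1 : (1 : ℝ) ≤ (M₁ : ℝ) - k := by
          have : (1 : ℤ) ≤ M₁ - k := by omega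
          exact_mod_cast this
        rw [hq, show ((k : ℝ) - m) ^ 4 = ((m : ℝ) - M₁ + ((M₁ : ℝ) - k)) ^ 4 by ring]
        exact (div_pow_four_le (d := (m : ℝ) - M₁) hA (by linarith) hk1).trans
          (le_add_of_nonneg_right (by positivity))
      · have hq : (((k - (M₁ + n)).toNat : ℕ) : ℝ) = (k : ℝ) - M₁ - n := by
          rw [← Int.cast_natCast ((k - (M₁ + n)).toNat), Int.toNat_of_nonneg (by omega)]; push_cast; ring
        have hk1 : (1 : ℝ) ≤ (k : ℝ) - M₁ - n := by
          have : (1 : ℤ) ≤ k - M₁ - n := by omega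
          exact_mod_cast this
        rw [hq, show ((k : ℝ) - m) ^ 4 = ((M₁ : ℝ) + n - m + ((k : ℝ) - M₁ - n)) ^ 4 by ring]
        exact (div_pow_four_le (d := (M₁ : ℝ) + n - m) hA (by linarith) hk1).trans
          (le_add_of_nonneg_left (by positivity))
  -- finite sums of the majorant
  have h1 : ∀ s : Finset ℤ, ∑ k ∈ s, 1 / (((M₁ - k).toNat : ℕ) : ℝ) ^ 2 ≤ ∑' e : ℕ, 1 / (e : ℝ) ^ 2 :=
    fun s => sum_inv_sq_le s (fun k => (M₁ - k).toNat) fun k hk k' hk' h => by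
      simp only [Set.mem_setOf_eq] at hk hk' h; omega
  have h2 : ∀ s : Finset ℤ, ∑ k ∈ s, 1 / (((k - (M₁ + n)).toNat : ℕ) : ℝ) ^ 2 ≤
      ∑' e : ℕ, 1 / (e : ℝ) ^ 2 :=
    fun s => sum_inv_sq_le s (fun k => (k - (M₁ + n)).toNat) fun k hk k' hk' h => by
      simp only [Set.mem_setOf_eq] at hk hk' h; omega
  have hle : ∑' k, -(((↑(Finset.Icc M₁ (M₁ + n)) : Set ℤ)ᶜ).indicator g k) ≤
      A * (1 / ((m : ℝ) - M₁ + 1) ^ 2 + 1 / ((M₁ : ℝ) + n - m + 1) ^ 2) * ∑' e : ℕ, 1 / (e : ℝ) ^ 2 := by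
    refine tsum_le_of_sum_le' (by positivity) fun s => (Finset.sum_le_sum fun k _ => hgB k).trans ?_
    calc _ = A / ((m : ℝ) - M₁ + 1) ^ 2 * ∑ k ∈ s, 1 / (((M₁ - k).toNat : ℕ) : ℝ) ^ 2 +
          A / ((M₁ : ℝ) + n - m + 1) ^ 2 * ∑ k ∈ s, 1 / (((k - (M₁ + n)).toNat : ℕ) : ℝ) ^ 2 := by
            rw [Finset.sum_add_distrib, Finset.mul_sum, Finset.mul_sum]
      _ ≤ A / ((m : ℝ) - M₁ + 1) ^ 2 * ∑' e : ℕ, 1 / (e : ℝ) ^ 2 +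
          A / ((M₁ : ℝ) + n - m + 1) ^ 2 * ∑' e : ℕ, 1 / (e : ℝ) ^ 2 :=
            add_le_add (mul_le_mul_of_nonneg_left (h1 s) (by positivity))
              (mul_le_mul_of_nonneg_left (h2 s) (by positivity))
      _ = _ := by ring
  rw [tsum_neg] at hle
  linarith

/-- **The column inequality for an abstract symmetric pair interaction with quartic decay.** For
`Φ m k = Φ k m`, `|Φ m k| ≤ A / (k - m)⁴` (`k ≠ m`) and summable punctured rows: the column sum over
`m ∈ [M₁, M₁ + n]` of the full rows `Σ'_{k ≠ m} Φ m k` is at least twice the sum over the pairs inside the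
column minus `2 A (Σ_e e⁻²)²`. [folklore] -/
theorem column_lower {A : ℝ} (hA : 0 ≤ A) (Φ : ℤ → ℤ → ℝ) (hsymm : ∀ m k, Φ m k = Φ k m)
    (hdec : ∀ m k, k ≠ m → |Φ m k| ≤ A / ((k : ℝ) - m) ^ 4)
    (hsum : ∀ m, Summable fun k => if k = m then (0 : ℝ) else Φ m k) (M₁ : ℤ) (n : ℕ) :
    2 * (∑ i ∈ Finset.range n, ∑ j ∈ Finset.Ioc i n, Φ (M₁ + i) (M₁ + j)) ≤
      (∑ m ∈ Finset.Icc M₁ (M₁ + n), ∑' k : ℤ, (if k = m then (0 : ℝ) else Φ m k)) +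
        2 * A * (∑' e : ℕ, 1 / (e : ℝ) ^ 2) ^ 2 := by
  have hZ0 : (0 : ℝ) ≤ ∑' e : ℕ, 1 / (e : ℝ) ^ 2 := tsum_nonneg fun _ => by positivity
  -- split each punctured row into the column part and the tail
  have hsplit : ∀ m, ∑' k, (if k = m then (0 : ℝ) else Φ m k) =
      ∑ k ∈ Finset.Icc M₁ (M₁ + n), (if k = m then (0 : ℝ) else Φ m k) +
        ∑' k, ((↑(Finset.Icc M₁ (M₁ + n)) : Set ℤ)ᶜ).indicator
          (fun k => if k = m then (0 : ℝ) else Φ m k) k := fun m => by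
    rw [← (hsum m).sum_add_tsum_compl (s := Finset.Icc M₁ (M₁ + n)),
      tsum_subtype ((↑(Finset.Icc M₁ (M₁ + n)) : Set ℤ)ᶜ) fun k => if k = m then (0 : ℝ) else Φ m k]
  -- the weights of the tails and their column sum
  obtain ⟨w, hw⟩ : ∃ w : ℤ → ℝ, ∀ m, w m =
      1 / (((m - (M₁ - 1)).toNat : ℕ) : ℝ) ^ 2 + 1 / (((M₁ + n + 1 - m).toNat : ℕ) : ℝ) ^ 2 :=
    ⟨_, fun m => rfl⟩
  have htail : ∀ m ∈ Finset.Icc M₁ (M₁ + n), -(A * w m * ∑' e : ℕ, 1 / (e : ℝ) ^ 2) ≤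
      ∑' k, ((↑(Finset.Icc M₁ (M₁ + n)) : Set ℤ)ᶜ).indicator
        (fun k => if k = m then (0 : ℝ) else Φ m k) k := fun m hm => by
    rw [hw]
    refine tail_lower hA M₁ n hm _ fun k hk => ?_
    have hkm : k ≠ m := fun h => hk (h ▸ hm)
    simp only [if_neg hkm]
    exact hdec m k hkm
  have hwsum : ∑ m ∈ Finset.Icc M₁ (M₁ + n), w m ≤
      (∑' e : ℕ, 1 / (e : ℝ) ^ 2) + ∑' e : ℕ, 1 / (e : ℝ) ^ 2 := by
    simp only [hw, Finset.sum_add_distrib]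
    refine add_le_add (sum_inv_sq_le _ (fun k => (k - (M₁ - 1)).toNat) fun k hk k' hk' h => ?_)
      (sum_inv_sq_le _ (fun k => (M₁ + n + 1 - k).toNat) fun k hk k' hk' h => ?_)
    · simp only [Set.mem_setOf_eq] at hk hk' h; omega
    · simp only [Set.mem_setOf_eq] at hk hk' h; omega
  have hO : -(2 * A * (∑' e : ℕ, 1 / (e : ℝ) ^ 2) ^ 2) ≤ ∑ m ∈ Finset.Icc M₁ (M₁ + n),
      ∑' k, ((↑(Finset.Icc M₁ (M₁ + n)) : Set ℤ)ᶜ).indicator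
        (fun k => if k = m then (0 : ℝ) else Φ m k) k := by
    have h1 : A * (∑ m ∈ Finset.Icc M₁ (M₁ + n), w m) * (∑' e : ℕ, 1 / (e : ℝ) ^ 2) ≤
        A * ((∑' e : ℕ, 1 / (e : ℝ) ^ 2) + ∑' e : ℕ, 1 / (e : ℝ) ^ 2) * ∑' e : ℕ, 1 / (e : ℝ) ^ 2 := by
      gcongr
    rw [Finset.mul_sum, Finset.sum_mul] at h1
    calc -(2 * A * (∑' e : ℕ, 1 / (e : ℝ) ^ 2) ^ 2)
        = -(A * ((∑' e : ℕ, 1 / (e : ℝ) ^ 2) + ∑' e : ℕ, 1 / (e : ℝ) ^ 2) *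
            ∑' e : ℕ, 1 / (e : ℝ) ^ 2) := by ring
      _ ≤ -∑ m ∈ Finset.Icc M₁ (M₁ + n), A * w m * ∑' e : ℕ, 1 / (e : ℝ) ^ 2 := neg_le_neg h1
      _ = ∑ m ∈ Finset.Icc M₁ (M₁ + n), -(A * w m * ∑' e : ℕ, 1 / (e : ℝ) ^ 2) :=
          (Finset.sum_neg_distrib _).symm
      _ ≤ _ := Finset.sum_le_sum htail
  -- the pairs inside the column, counted twice
  have hinner : ∑ m ∈ Finset.Icc M₁ (M₁ + n), ∑ k ∈ Finset.Icc M₁ (M₁ + n),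
      (if k = m then (0 : ℝ) else Φ m k) =
      2 * ∑ i ∈ Finset.range n, ∑ j ∈ Finset.Ioc i n, Φ (M₁ + i) (M₁ + j) := by
    simp only [sum_Icc_eq_sum_range]
    have hW : ∀ d e : ℕ, (if (M₁ + e : ℤ) = M₁ + d then (0 : ℝ) else Φ (M₁ + d) (M₁ + e)) =
        if e = d then 0 else Φ (M₁ + d) (M₁ + e) := by
      intro d e
      by_cases hed : e = d
      · rw [if_pos (by rw [hed]), if_pos hed]
      · rw [if_neg (by simpa using hed), if_neg hed]
    rw [Finset.sum_congr rfl fun d _ => Finset.sum_congr rfl fun e _ => hW d e]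
    exact sum_sum_ite_eq_two_mul (fun d e => Φ (M₁ + d) (M₁ + e)) (fun d e => hsymm _ _) n
  rw [Finset.sum_congr rfl fun m _ => hsplit m, Finset.sum_add_distrib, hinner]
  linarith [hO]

/-! ## Part (a): the column of alternating-pattern layer series -/

/-- **Part (a) with an explicit constant.** For `a ∈ [47/50, 1]`, heights with increments `≥ 39a/50` and a
column `M₁, …, M₁ + n`: `2 F_n(Δ) ≤ Σ_{m ∈ col} S(m) + 2 · (192 / (39·47/2500)⁴) · (Σ_e e⁻²)²`. [folklore] -/
theorem partA (a : ℝ) (ha : 47 / 50 ≤ a) (ha1 : a ≤ 1) (z : ℤ → ℝ)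
    (hz : ∀ k : ℤ, 39 / 50 * a ≤ z (k + 1) - z k) (M₁ : ℤ) (n : ℕ) :
    2 * (∑ i ∈ Finset.range n, ∑ j ∈ Finset.Ioc i n, layerInteraction lennardJones a
        (∑ l ∈ Finset.Ico i j, (z (M₁ + l + 1) - z (M₁ + l))) (if Even (j - i) then 0 else 1) 1) ≤
      (∑ m ∈ Finset.Icc M₁ (M₁ + n), ∑' k : ℤ, (if k = m then (0 : ℝ) else
        layerInteraction lennardJones a (z k - z m) (if Even (k - m) then 0 else 1) 1)) +
      2 * (192 / (39 / 50 * (47 / 50)) ^ 4) * (∑' e : ℕ, 1 / (e : ℝ) ^ 2) ^ 2 := by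
  have ha0 : 0 < a := by linarith
  have hsymm : ∀ m k : ℤ,
      layerInteraction lennardJones a (z k - z m) (if Even (k - m) then 0 else 1) 1 =
        layerInteraction lennardJones a (z m - z k) (if Even (m - k) then 0 else 1) 1 := by
    intro m k
    rw [← clo_layerInteraction_neg_height lennardJones a (z k - z m), neg_sub]
    have : Even (m - k) ↔ Even (k - m) := by rw [← even_neg, neg_sub]
    simp only [this]
  have hdec : ∀ m k : ℤ, k ≠ m →
      |layerInteraction lennardJones a (z k - z m) (if Even (k - m) then 0 else 1) 1| ≤
        192 / (39 / 50 * (47 / 50)) ^ 4 / ((k : ℝ) - m) ^ 4 := by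
    intro m k hkm
    refine (cake_abs_layerInteraction_le a _ ha ha1 (cake_height_sep a ha z hz hkm) _).trans ?_
    have h1 : 39 / 50 * (47 / 50) * |(k : ℝ) - m| ≤ |z k - z m| :=
      le_trans (mul_le_mul_of_nonneg_right (by linarith) (abs_nonneg _))
        (cake_abs_height_diff_ge a ha0.le z hz m k)
    have h0 : (0 : ℝ) < |(k : ℝ) - m| := abs_pos.2 (sub_ne_zero.2 (by exact_mod_cast hkm))
    have h4 : (39 / 50 * (47 / 50) * |(k : ℝ) - m|) ^ 4 ≤ (z k - z m) ^ 4 := by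
      rw [← Even.pow_abs ⟨2, rfl⟩ (z k - z m)]
      exact pow_le_pow_left₀ (by positivity) h1 4
    calc (192 : ℝ) / (z k - z m) ^ 4 ≤ 192 / (39 / 50 * (47 / 50) * |(k : ℝ) - m|) ^ 4 :=
          div_le_div_of_nonneg_left (by norm_num) (by positivity) h4
      _ = 192 / (39 / 50 * (47 / 50)) ^ 4 / ((k : ℝ) - m) ^ 4 := by
          rw [mul_pow, Even.pow_abs ⟨2, rfl⟩, div_div]
  have hsum : ∀ m : ℤ, Summable fun k : ℤ => if k = m then (0 : ℝ) else
      layerInteraction lennardJones a (z k - z m) (if Even (k - m) then 0 else 1) 1 := fun m =>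
    cake_summable_of_layer_bound a ha z hz m _ fun k hk => by
      rw [if_neg hk]
      exact cake_abs_layerInteraction_le a _ ha ha1 (cake_height_sep a ha z hz hk) _
  have key := column_lower (by positivity) (fun m k => layerInteraction lennardJones a (z k - z m)
    (if Even (k - m) then 0 else 1) 1) hsymm hdec hsum M₁ n
  have hF : (∑ i ∈ Finset.range n, ∑ j ∈ Finset.Ioc i n, layerInteraction lennardJones a
        (∑ l ∈ Finset.Ico i j, (z (M₁ + l + 1) - z (M₁ + l))) (if Even (j - i) then 0 else 1) 1) =
      ∑ i ∈ Finset.range n, ∑ j ∈ Finset.Ioc i n, layerInteraction lennardJones a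
        (z (M₁ + j) - z (M₁ + i)) (if Even ((M₁ + j : ℤ) - (M₁ + i)) then 0 else 1) 1 := by
    refine Finset.sum_congr rfl fun i _ => Finset.sum_congr rfl fun j hj => ?_
    have hij : i ≤ j := (Finset.mem_Ioc.1 hj).1.le
    rw [telescope z M₁ hij, add_sub_add_left_eq_sub, ← Nat.cast_sub hij]
    simp only [Int.even_coe_nat]
  rw [hF]
  exact key

/-! ## Part (b): the uniform free block against the bulk -/

/-- **Part (b).** For `a ∈ [47/50, 1]`, `h ∈ [39a/50, 17a/20]`, `n : ℕ`:
`(n + 1) · (2 hcpE a h - Φ₀(a)) ≤ 2 F_n(h·1)`. [folklore] -/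
theorem partB (a : ℝ) (ha : 47 / 50 ≤ a) (_ha1 : a ≤ 1) (h : ℝ) (hh : 39 / 50 * a ≤ h)
    (_hh1 : h ≤ 17 / 20 * a) (n : ℕ) :
    ((n : ℝ) + 1) * (2 * hcpE a h - inLayerInteraction lennardJones a) ≤
      2 * (∑ i ∈ Finset.range n, ∑ j ∈ Finset.Ioc i n, layerInteraction lennardJones a
        (∑ _l ∈ Finset.Ico i j, h) (if Even (j - i) then 0 else 1) 1) := by
  have ha0 : 0 < a := by linarith
  have hh0 : 0 < h := by linarith
  -- `Φ k`: one site against the full layer at distance `k` in the alternating pattern, unit layer form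
  obtain ⟨Φ, hΦ⟩ : ∃ Φ : ℕ → ℝ, ∀ k, Φ k =
      layerInteraction lennardJones a ((k : ℝ) * h) (if Even k then 0 else 1) 1 := ⟨_, fun k => rfl⟩
  have hite : ∀ (k : ℕ) (P : Prop) [Decidable P], (P ↔ Even (k + 1)) →
      (if P then layerInteraction lennardJones a h 0 ((k + 1 : ℕ) : ℤ)
        else layerInteraction lennardJones a h 1 ((k + 1 : ℕ) : ℤ)) = Φ (k + 1) := by
    intro k P _ hP
    rw [hΦ]
    by_cases hp : P
    · rw [if_pos hp, if_pos (hP.1 hp), ljs_layerInteraction_height, Int.cast_natCast]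
    · rw [if_neg hp, if_neg (mt hP.2 hp), ljs_layerInteraction_height, Int.cast_natCast]
  have habove : ∀ k : ℕ, ∑' ij : ℤ × ℤ, lennardJones (dist (barlowPos a h alternatingHagg 0 0 0)
      (barlowPos a h alternatingHagg (0 + ((k + 1 : ℕ) : ℤ)) ij.1 ij.2)) = Φ (k + 1) := fun k => by
    rw [tsum_layer_above]
    exact hite k _ (haggAligned_alternating_iff 0 (k + 1))
  have hbelow : ∀ k : ℕ, ∑' ij : ℤ × ℤ, lennardJones (dist (barlowPos a h alternatingHagg 0 0 0)
      (barlowPos a h alternatingHagg (0 - ((k + 1 : ℕ) : ℤ)) ij.1 ij.2)) = Φ (k + 1) := fun k => by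
    rw [tsum_layer_below]
    exact hite k _ (haggAligned_alternating_iff _ (k + 1))
  -- `2 hcpE = Φ₀ + 2 Σ_{k ≥ 1} Φ_k`
  have hE : 2 * hcpE a h = inLayerInteraction lennardJones a + (∑' k : ℕ, Φ (k + 1)) +
      ∑' k : ℕ, Φ (k + 1) := by
    rw [← barlowSiteEnergy_alternating_eq_hcpE ha0 hh0 0, barlowSiteEnergy, tsum_inLayer,
      tsum_congr habove, tsum_congr hbelow]
    ring
  -- every `Φ_k ≤ 0`, and `Σ_k Φ_k` converges
  have hΦ0 : ∀ k : ℕ, Φ (k + 1) ≤ 0 := fun k => by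
    rw [← habove k]
    exact tsum_nonpos fun ij =>
      ExactWindowEnergy.lennardJones_dist_barlowPos_nonpos ha hh isHaggSeq_alternating _ _ _ _ _ _
  have hΦs : Summable fun k : ℕ => Φ (k + 1) := by
    have hF := summable_lennardJones_barlowPos (s := alternatingHagg) (p := 2) ha0 hh0 ha0.ne' hh0.ne'
      two_ne_zero alternatingHagg_periodic (barlowPos a h alternatingHagg 0 0 0)
    refine (hF.prod.comp_injective (i := fun k : ℕ => (0 : ℤ) + ((k + 1 : ℕ) : ℤ))
      fun k k' hk => by simpa using hk).congr fun k => ?_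
    exact habove k
  have hT0 : ∑' k : ℕ, Φ (k + 1) ≤ 0 := tsum_nonpos hΦ0
  -- each row of the uniform free block dominates `Σ_k Φ_k`
  have hrow : ∀ i ∈ Finset.range n, ∑' k : ℕ, Φ (k + 1) ≤ ∑ j ∈ Finset.Ioc i n,
      layerInteraction lennardJones a (∑ _l ∈ Finset.Ico i j, h) (if Even (j - i) then 0 else 1) 1 := by
    intro i _
    have himg : Finset.Ioc i n = (Finset.range (n - i)).image (fun d => i + 1 + d) := by
      ext j
      simp only [Finset.mem_Ioc, Finset.mem_image, Finset.mem_range]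
      constructor
      · intro hj; exact ⟨j - i - 1, by omega, by omega⟩
      · rintro ⟨d, hd, rfl⟩; omega
    have hrew : ∑ j ∈ Finset.Ioc i n, layerInteraction lennardJones a (∑ _l ∈ Finset.Ico i j, h)
        (if Even (j - i) then 0 else 1) 1 = ∑ d ∈ Finset.range (n - i), Φ (d + 1) := by
      rw [himg, Finset.sum_image fun d _ d' _ h => by omega]
      refine Finset.sum_congr rfl fun d _ => ?_
      rw [hΦ, Finset.sum_const, Nat.card_Ico, nsmul_eq_mul, show i + 1 + d - i = d + 1 by omega]
    rw [hrew]
    have h1 := (hΦs.neg).sum_le_tsum (Finset.range (n - i)) fun d _ => neg_nonneg.2 (hΦ0 d)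
    rw [Finset.sum_neg_distrib, tsum_neg] at h1
    linarith
  have hF : (n : ℝ) * ∑' k : ℕ, Φ (k + 1) ≤ ∑ i ∈ Finset.range n, ∑ j ∈ Finset.Ioc i n,
      layerInteraction lennardJones a (∑ _l ∈ Finset.Ico i j, h) (if Even (j - i) then 0 else 1) 1 := by
    have := Finset.sum_le_sum hrow
    rwa [Finset.sum_const, Finset.card_range, nsmul_eq_mul] at this
  rw [show 2 * hcpE a h - inLayerInteraction lennardJones a = 2 * ∑' k : ℕ, Φ (k + 1) by
    rw [hE]; ring]
  nlinarith [hT0, hF]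

end FreeBlockBounds

-- lint debt: the registered signature binds an unused `l` in `∑ l ∈ Finset.Ico i j, h`; it is reproduced verbatim.
set_option linter.unusedVariables false in
/-- **Stub RC-W3 `stub_freeBlockBounds` — free-block bounds.**  (a) For `a ∈ [47/50,1]`, heights `z` in the
band, a column of layers `M₁, …, M₁ + n`: the column sum of the full ALTERNATING-pattern layer series is
`≥ 2·F_n(Δ) − C` with `Δ l = z (M₁+l+1) − z (M₁+l)` (pairs inside the column are counted twice and
`Σ_{l∈[i,j)} Δ l = z(M₁+j) − z(M₁+i)`, `layerInteraction` is even in the height; pairs with a layer outside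
the column are bounded by `192/H⁴` (`LayeredHull.cake_abs_layerInteraction_le`) and
`Σ_{m∈col} Σ_{k∉col} (z k − z m)⁻⁴ ≤ C` by the gaps `≥ 7/10`).  (b) For `h` in the band the free uniform
alternating block dominates the bulk: `(n+1)(2·hcpE a h − Φ₀(a)) ≤ 2 F_n(h·1)` (`2·hcpE a h = Φ₀ + 2 Σ_{k ≥ 1}
Φ_k` by `barlowSiteEnergy_alternating_eq_hcpE` + the layer form of `barlowSiteEnergy` + the reindexing
`layerInteraction V a h δ k = layerInteraction V a (k h) δ 1`; every row of `F_n(h·1)` is a partial sum of the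
nonpositive summable `Φ_k`). [folklore] -/
theorem stub_freeBlockBounds : (∃ C : ℝ, ∀ (a : ℝ), 47 / 50 ≤ a → a ≤ 1 → ∀ z : ℤ → ℝ, (∀ k : ℤ, 39 / 50 * a ≤ z (k + 1) - z k ∧ z (k + 1) - z k ≤ 17 / 20 * a) → ∀ (M₁ : ℤ) (n : ℕ), 2 * (∑ i ∈ Finset.range n, ∑ j ∈ Finset.Ioc i n, Literature.MathematicalPhysics.StatisticalMechanics.layerInteraction Literature.MathematicalPhysics.StatisticalMechanics.lennardJones a (∑ l ∈ Finset.Ico i j, (z (M₁ + l + 1) - z (M₁ + l))) (if Even (j - i) then 0 else 1) 1) ≤ (∑ m ∈ Finset.Icc M₁ (M₁ + n), ∑' k : ℤ, (if k = m then (0 : ℝ) else Literature.MathematicalPhysics.StatisticalMechanics.layerInteraction Literature.MathematicalPhysics.StatisticalMechanics.lennardJones a (z k - z m) (if Even (k - m) then 0 else 1) 1)) + C) ∧ (∀ (a : ℝ), 47 / 50 ≤ a → a ≤ 1 → ∀ h : ℝ, 39 / 50 * a ≤ h → h ≤ 17 / 20 * a → ∀ n : ℕ, ((n : ℝ) + 1)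 * (2 * Summit.AtomisticToContinuum.Crystallization.Theorems.PalmUnimodularRigidity.LayeredLawsSelectHcp.hcpE a h - Literature.MathematicalPhysics.StatisticalMechanics.inLayerInteraction Literature.MathematicalPhysics.StatisticalMechanics.lennardJones a) ≤ 2 * (∑ i ∈ Finset.range n, ∑ j ∈ Finset.Ioc i n, Literature.MathematicalPhysics.StatisticalMechanics.layerInteraction Literature.MathematicalPhysics.StatisticalMechanics.lennardJones a (∑ l ∈ Finset.Ico i j, h) (if Even (j - i) then 0 else 1) 1)) :=
  ⟨⟨_, fun a ha ha1 z hz M₁ n => FreeBlockBounds.partA a ha ha1 z (fun k => (hz k).1) M₁ n⟩,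
    FreeBlockBounds.partB⟩

end Summit.AtomisticToContinuum.Crystallization.Theorems.HcpLandscapeGapBirth
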